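/-
Copyright (c) 2026 the pub-hodgecm-mathlib formalisation cell (harness21).  Prover seat hodgecm-mathlib-K2E3-p25 (g3) (L4 architect), HCML Track B «K2-LIT» ∕ h413
(`stmt-HodgeConjecture-24833`).  NR-1′ «LeThree SWEEP» (director s1979∕s1980): the hHC∕hHCB-binding theorems of ★ `F0P3cStCharTSL2dOfHcb` RE-READ under the NARROWED letters
hHC₃ `characterLocallyIntegrableLeThree` ∕ hHCB₃ `normalizedCharacter_locallyBoundedLeThree` (`2 ≤ N ≤ 3`, `v` non-split) — SAME NAMES, namespace `…K2E3L2dOfHcbLeThree`.  2026-09-04.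
-/
import Literature.NumberTheory.Rogawski1990.Ch12Sec7CharacterInputs        -- ★ p850727 (F-b) the NAMED FACT `normalizedCharacter_locallyBounded` [HarishChandra1999AdmissibleDistributions Thm. 16.3; Rogawski1990 §1.6 p. 5]
import Literature.NumberTheory.Rogawski1990.Ch12Sec5Inputs                 -- ★ TR carpet: the (S-𝔇) socket (L2D∀) `EllipticData.L2CharOnTorusAll` (and (M1) `CharRegularity`)
import Literature.NumberTheory.Rogawski1990.CMLocalAPacketMembers          -- ★ `Gqs` (`U(Φ₃)(L⁺_v)`), `qsForm`
import Literature.NumberTheory.Automorphic.LocalUnitaryGroupCongr          -- ★ `antidiagOne_isHermitian`, `isUnit_antidiagOne_det` (the antecedents of (F-b) at `Φ₃`)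
import HarnessLib
import Summits.HodgeConjecture.HodgeConjecture.Theorems.F0P3cStCharTSL2dOfHcb   -- ★ the original: every non-letter lemma REUSED by qualified name
import Summits.HodgeConjecture.HodgeConjecture.Theorems.K2E3CharLettersLeThreeDefs   -- NR-1′ root: hHC₃ ∕ hHCB₃

/-!
# NR-1′ twin — ★ `F0P3cStCharTSL2dOfHcb` under the narrowed Harish-Chandra letters (`2 ≤ N ≤ 3`, `v` non-split)

Cell `pub/hodgecm-mathlib`, crux H413 = `stmt-HodgeConjecture-24833`, line L4 `stub_StCharTS`; director rulings NR-1′ (s1979) ∕ «GO — LeThree SWEEP» (s1980); architect memo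
`K2/K2E3-p25/g3/NR1-narrowing-cone.K2E3-p25-g3.md`.  THEOREMS ONLY; count-neutral helper (`--supports stmt-HodgeConjecture-24833 --as helper`).  Exactly the theorems of the
original ★ file whose statements bind `Ch1.characterLocallyIntegrable` ∕ `normalizedCharacter_locallyBounded`, copied with the binder TYPE replaced by hHC₃ ∕ hHCB₃
(★ `K2E3CharLettersLeThreeDefs`), the rank∕non-split arguments supplied at each application (`2 ≤ N`, `N ≤ 3` by `norm_num`; the organ's `∀ w ∣ v, conj • w = w`), an added `hns`
binder where the original head was place-agnostic, and calls into other cone files re-pointed to their twins; every other lemma of the original is used BY QUALIFIED NAME.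
No new mathematics.  The original ★ declarations are untouched.

HONEST LABEL: HC_CM is proved only modulo the 7 printed citations (2 remaining named inputs: hLiu418 = `stmt-HodgeConjecture-24832`, h413 = `stmt-HodgeConjecture-24833`) until rung 0
closes; count-neutral; CONDITIONAL on the narrowed letters (stated, not assumed).

## References
* [Rogawski1990] J. D. Rogawski, *Automorphic Representations of Unitary Groups in Three Variables* (1990), §1.6 p. 5; §4.9 p. 54; §12.5–12.7.
* [HarishChandra1999AdmissibleDistributions] Harish-Chandra, *Admissible Invariant Distributions on Reductive p-adic Groups*, ULS 16 (1999), Thm. 16.3.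
-/

set_option autoImplicit false
-- the mandated namespace has the single-problem summit's repeated segment (`HodgeConjecture.HodgeConjecture`)
set_option linter.dupNamespace false

noncomputable section

open MeasureTheory Filter Topology
open NumberField IsDedekindDomain
open scoped NNReal
open Literature.NumberTheory.Automorphic Literature.NumberTheory.Automorphic.UnitaryGroup Literature.NumberTheory.Rogawski1990

open Summit.HodgeConjecture.HodgeConjecture.Cruxes.H413.K2E3CharLettersLeThreeDefs

namespace Summit.HodgeConjecture.HodgeConjecture.Cruxes.H413.K2E3L2dOfHcbLeThree

variable (L : Type) [Field L] [NumberField L] [IsCMField L] (v : HeightOneSpectrum (𝓞 ↥(maximalRealSubfield L)))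

/-! ## §1 One torus: a Harish-Chandra bound on a compact `T` of finite mass puts `D_G·Θ|_T` in `L²` -/

/-! ## §2 The slice: (L2D∀) at a datum with compact elliptic representatives of finite mass, from (F-b) + (M1∀) -/

/-- **S9c «L2D-OF-HCB★» — the socket (L2D∀) ★ `EllipticData.L2CharOnTorusAll` from Harish-Chandra's local boundedness (F-b) + (M1∀).**  On `Gqs L v = U(Φ₃)(L⁺_v)` with a
Haar measure `νQv` (binder-supplied Borel structure): for every §12.5 datum `𝔇` with COMPAT `𝔇.μG = νQv`, `𝔇.regG ↔ IsRegularElt`, the (M1∀) socket of the leaf (ED. 17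
text: for EVERY class, `𝔇.char π` measurable, locally integrable, locally constant on `G^{reg}`, representing the trace), and the SLICE HYPOTHESES on its Cartan data
(PLAN S9 D3∕D4∕D5): `𝔇.DG` measurable; every `T ∈ 𝔇.cartanG` compact in `G` with `𝔇.μT T` finite; at each `t ∈ T`, `𝔇.DG t = 0` or `|𝔇.DG t| ≤ √√‖u‖` for a unit `u` with
`u·det(t)² = disc(charpoly t)` — GIVEN (F-b) `hHC : normalizedCharacter_locallyBoundedLeThree`, (L2D∀) holds: `D_G·χ_π ∈ L²(T, dγ)` for every class `π` and every `T ∈ cartanG`.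
[cite: Rogawski1990, §12.7 Lemma 12.7.2 (proof) p. 193; §12.5 p. 184; §1.6 p. 5; §4.9 p. 54] [cite: HarishChandra1999AdmissibleDistributions, Part III §16 Thm. 16.3] -/
theorem l2CharOnTorusAll_of_hcBounded (hHC : normalizedCharacter_locallyBoundedLeThree)
    (hns : ∀ w : PlacesOver L v, IsCMField.complexConj L • w.1 = w.1)
    [MeasurableSpace (Gqs L v)] [BorelSpace (Gqs L v)]
    [∀ γ : Gqs L v, MeasurableSpace (Gqs L v ⧸ Subgroup.centralizer ({γ} : Set (Gqs L v)))] [MeasurableSpace (Gqs L v ⧸ Subgroup.center (Gqs L v))]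
    {H : Type} [Group H] [TopologicalSpace H] [IsTopologicalGroup H] [MeasurableSpace H]
    (νQv : Measure (Gqs L v)) [νQv.IsHaarMeasure]
    (𝔇 : Ch12Sec5.EllipticData (Gqs L v) H) (hμG : 𝔇.μG = νQv)
    (hreg : ∀ γ : Gqs L v, γ ∈ 𝔇.regG ↔ IsRegularElt (γ.val : GL (Fin 3) (UnitaryGroup.LocalRing L v)))
    (hM1 : ∀ π : IrrClass (Gqs L v), Measurable (𝔇.char π) ∧ LocallyIntegrable (𝔇.char π) 𝔇.μG ∧
      (∀ x ∈ 𝔇.regG, ∀ᶠ y in 𝓝 x, 𝔇.char π y = 𝔇.char π x) ∧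
      ∀ φ : Gqs L v → ℂ, IsLocSmooth φ → π.smoothTrace 𝔇.μG φ = ∫ x, φ x * 𝔇.char π x ∂𝔇.μG)
    (hDGm : Measurable 𝔇.DG)
    (hK : ∀ T ∈ 𝔇.cartanG, IsCompact (T : Set (Gqs L v)))
    (hF : ∀ T ∈ 𝔇.cartanG, IsFiniteMeasure (𝔇.μT T))
    (hDG : ∀ T ∈ 𝔇.cartanG, ∀ t : ↥T, 𝔇.DG (t : Gqs L v) = 0 ∨ ∃ u : (UnitaryGroup.LocalRing L v)ˣ,
      (u : UnitaryGroup.LocalRing L v) * ((((t : Gqs L v)).val : GL (Fin 3) (UnitaryGroup.LocalRing L v)).val.det) ^ (3 - 1) =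
          ((((t : Gqs L v)).val : GL (Fin 3) (UnitaryGroup.LocalRing L v)).val.charpoly).discr ∧
        |𝔇.DG (t : Gqs L v)| ≤ ((NNReal.sqrt (NNReal.sqrt (unitModulusChar (UnitaryGroup.LocalRing L v) u)) : ℝ≥0) : ℝ)) :
    𝔇.L2CharOnTorusAll := by
  intro π T hT
  obtain ⟨hm, hli, hlc, htr⟩ := hM1 π
  rw [hμG] at hli htr
  have hlc' : ∀ x : Gqs L v, IsRegularElt (x.val : GL (Fin 3) (UnitaryGroup.LocalRing L v)) → ∀ᶠ y in 𝓝 x, 𝔇.char π y = 𝔇.char π x :=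
    fun x hx => hlc x ((hreg x).2 hx)
  obtain ⟨B, hB⟩ := hHC L 3 (by norm_num) le_rfl (qsForm L) (antidiagOne_isHermitian L 3) (isUnit_antidiagOne_det L 3).ne_zero v hns νQv π (𝔇.char π)
    hli hlc' htr (T : Set (Gqs L v)) (hK T hT)
  haveI := hF T hT
  exact F0P3cStCharTSL2dOfHcb.memLp_mul_of_hcBound_on_subgroup L v T (𝔇.μT T) hDGm hm hB (hDG T hT)

/-- **(L2D-ell) in the leaf's ED. 17 text** («… for every ELLIPTIC `π`») — the corollary of §2 the ED. pen can `exact` in the `hL2ell` slot once the constructor supplies the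
slice hypotheses. [cite: Rogawski1990, §12.7 Lemma 12.7.2 (proof) p. 193; §12.5 p. 184] -/
theorem l2dEll_of_hcBounded (hHC : normalizedCharacter_locallyBoundedLeThree)
    (hns : ∀ w : PlacesOver L v, IsCMField.complexConj L • w.1 = w.1)
    [MeasurableSpace (Gqs L v)] [BorelSpace (Gqs L v)]
    [∀ γ : Gqs L v, MeasurableSpace (Gqs L v ⧸ Subgroup.centralizer ({γ} : Set (Gqs L v)))] [MeasurableSpace (Gqs L v ⧸ Subgroup.center (Gqs L v))]
    {H : Type} [Group H] [TopologicalSpace H] [IsTopologicalGroup H] [MeasurableSpace H]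
    (νQv : Measure (Gqs L v)) [νQv.IsHaarMeasure]
    (𝔇 : Ch12Sec5.EllipticData (Gqs L v) H) (hμG : 𝔇.μG = νQv)
    (hreg : ∀ γ : Gqs L v, γ ∈ 𝔇.regG ↔ IsRegularElt (γ.val : GL (Fin 3) (UnitaryGroup.LocalRing L v)))
    (hM1 : ∀ π : IrrClass (Gqs L v), Measurable (𝔇.char π) ∧ LocallyIntegrable (𝔇.char π) 𝔇.μG ∧
      (∀ x ∈ 𝔇.regG, ∀ᶠ y in 𝓝 x, 𝔇.char π y = 𝔇.char π x) ∧
      ∀ φ : Gqs L v → ℂ, IsLocSmooth φ → π.smoothTrace 𝔇.μG φ = ∫ x, φ x * 𝔇.char π x ∂𝔇.μG)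
    (hDGm : Measurable 𝔇.DG)
    (hK : ∀ T ∈ 𝔇.cartanG, IsCompact (T : Set (Gqs L v)))
    (hF : ∀ T ∈ 𝔇.cartanG, IsFiniteMeasure (𝔇.μT T))
    (hDG : ∀ T ∈ 𝔇.cartanG, ∀ t : ↥T, 𝔇.DG (t : Gqs L v) = 0 ∨ ∃ u : (UnitaryGroup.LocalRing L v)ˣ,
      (u : UnitaryGroup.LocalRing L v) * ((((t : Gqs L v)).val : GL (Fin 3) (UnitaryGroup.LocalRing L v)).val.det) ^ (3 - 1) =
          ((((t : Gqs L v)).val : GL (Fin 3) (UnitaryGroup.LocalRing L v)).val.charpoly).discr ∧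
        |𝔇.DG (t : Gqs L v)| ≤ ((NNReal.sqrt (NNReal.sqrt (unitModulusChar (UnitaryGroup.LocalRing L v) u)) : ℝ≥0) : ℝ)) :
    ∀ π : IrrClass (Gqs L v), 𝔇.IsEllipticRep π →
      ∀ T ∈ 𝔇.cartanG, MemLp (fun t : ↥T => (𝔇.DG (t : Gqs L v) : ℂ) * 𝔇.char π (t : Gqs L v)) 2 (𝔇.μT T) :=
  fun π _ => l2CharOnTorusAll_of_hcBounded L v hHC hns νQv 𝔇 hμG hreg hM1 hDGm hK hF hDG π

end Summit.HodgeConjecture.HodgeConjecture.Cruxes.H413.K2E3L2dOfHcbLeThree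

end
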